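import Literature.NumberTheory.Automorphic.Liu2021.Def411WeilCarriersLocalDataAtV
import Literature.NumberTheory.Automorphic.Liu2021.Def411WeilCarriersTripleSeparation
import Literature.RepresentationTheory.CentralCharacterQuotientSemilinear
import HarnessLib

/-!
# [Liu2021, Thm 4.18 (3)] road, piece III-11a (assembly, layer A): a SEMILINEAR intertwiner of two oscillator representations of the
# indexed family at `v` descends to a semilinear bijection of their `χ`-quotients `ω(μ_i, ε_i, χ_i)`

Topic `NumberTheory/Automorphic/Liu2021`; namespace `Literature.NumberTheory.Automorphic.Liu2021.Def411WeilCarriers` (continuing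
`Def411WeilCarriersLocalDataAtV.lean` §5: the INDEXED FAMILY `localIndexedFamilyAtV … v` of [Liu2021, App. D §D.1]'s data at a finite place).
KERNEL ONLY: theorems; no definition, no named fact, no `sorry`.

THE STATEMENT (`exists_semilinear_quot_of_omega_intertwiner`).  Members `i₀`, `i₁` of the indexed family (SAME standing data `S`, lines `⟨a_{i₀}⟩`,
`⟨a_{i₁}⟩`, splittings `𝓢_{i₀}`, `𝓢_{i₁}`, global centre characters `χ_{i₀}`, `χ_{i₁}`), a field endomorphism `τ : ℂ →+* ℂ` (in the application
`σ ∈ Aut(ℂ/M_μ)`), and a `τ`-SEMILINEAR BIJECTION `Φ` of the common carrier `𝒮(F_vⁿ)` INTERTWINING the two oscillator representations of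
`U(J_V)(F_v)` — `Φ (ω_{i₀}(g) f) = ω_{i₁}(g) (Φ f)` — together with `χ_{i₁} = τ ∘ χ_{i₀}` on `E¹(𝔸_{F,f})`: then there is a `τ`-semilinear bijection
of the Step-3 quotients `ω(μ_{i₀}, ε_{i₀}, χ_{i₀}) → ω(μ_{i₁}, ε_{i₁}, χ_{i₁})` (the family's `quot`, = `CentralCharacterQuotient.quotRep`) intertwining
the `U(J_V)(F_v)`-actions — exactly the conclusion shape of the face Prop `LocalTypeGaloisTwist` of the cell `hodgecm-mathlib`
(`Summits/…/HypLiu418/A3Liu418EpsRigidFaceTypes.lean`).  PROOF: `CentralCharacterQuotient.exists_semilinear_quotRep_of_bijective` (semilinear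
transport of maximal `χ`-quotients, tree) once the local centre characters satisfy `χ_{i₁,v} ∘ θ = τ ∘ (χ_{i₀,v} ∘ θ)` on `E_v¹`; that follows
from the global relation because the local component `χ_{1,v}(θ z)` does not depend on the line through which the centre is presented
(`localCharOfCenter_theta_eq`) and is `χ₁` read through the place inclusion (`localCharOfCenter_eq_comp_inclPlace`).
The INPUT `Φ` is produced elsewhere (layer B of the road: the Galois twist `f ↦ σ ∘ f` of the Schrödinger model,
`HeisenbergGroup/SchrodingerGaloisTwist.lean` + `GelbartRogawski1991/LocalMpGaloisTwist.lean`, the dilation `ψ_v(κ·) ↔ ⟨t a⟩`,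
`SchrodingerAddCharDilation.lean`/`LocalMpAddCharRescaling.lean`, and the `σ`-stability of the μ-normalised splitting).
HC_CM is proved only modulo the 7 printed citations until rung 0 of the ladder closes; nothing about it is claimed here.

## References
* [Liu2021] Y. Liu, Camb. J. Math. 9 (2021) = arXiv:2102.11518, Thm. 4.18 (3) with proof l. 2272–2289; App. D §D.1 Steps 1–3 (l. 5213–5224).
* [TateThesis1967] J. Tate, in Cassels–Fröhlich (1967), §3.2 Lemma 3.2.1 (characters of restricted products are products of local components).
-/

set_option autoImplicit false

noncomputable section

open scoped Matrix Kronecker RestrictedProduct NumberField Classical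
open NumberField IsDedekindDomain Filter Set
open Literature.NumberTheory Literature.NumberTheory.Automorphic Literature.NumberTheory.Automorphic.UnitaryGroup
open Literature.NumberTheory.GelbartRogawski1991 Literature.NumberTheory.GelbartRogawski1991.UnitaryDualPair
open Literature.RepresentationTheory
open Literature.RepresentationTheory.CentralCharacterQuotient (augmentation quotRep exists_semilinear_quotRep_of_bijective)

namespace Literature.NumberTheory.Automorphic.Liu2021.Def411WeilCarriers

variable (F E : Type) [Field F] [NumberField F] [Field E] [NumberField E] [Algebra F E]
variable (c : E ≃ₐ[F] E) (N : ℕ) {n : ℕ} (e : Fin N × Fin 1 ≃ Fin n)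
variable (JV : Matrix (Fin N) (Fin N) E) {TV : Matrix (Fin N) (Fin N) F}
variable [Algebra.IsQuadraticExtension F E] {δ : E} (hcδ : c δ = -δ) (hδ : δ ≠ 0) {d : F} (hd : δ * δ = algebraMap F E d)

/-- **The Step-3 character of member `i` at `z ∈ E_v¹` is the global centre character `χ_i` at one adelic point that does not depend on the
member's line `⟨a_i⟩`** — `χ_{i,v}(θ_{a_i} z) = χ_{i,v}(θ_{a} z)` read at ANY line `⟨a⟩` (`localCharOfCenter_theta_eq`). [cite: TateThesis1967, §3.2 Lemma 3.2.1]
[cite: Liu2021, App. D §D.1 Step 3 (l. 5221)] -/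
theorem coe_chi_localIndexedFamilyAtV_apply (hV : TV.IsSymm) (hVd : IsUnit TV.det)
    (hJV : JV = TV.map (algebraMap F E))
    (hn : 3 ≤ n) {ι : Type} (aOf : ι → Fˣ) (χOf : ι → Chi F E c)
    (𝓢Of : ∀ i, LocalSplitting.FinLocalSplittings F E c n hcδ hδ hd (gram F e TV (TW F (aOf i))) (isSymm_gram F e hV (isSymm_TW F (aOf i)))
      (reindex_kronecker_eq_gram_map F E e hJV (JW_eq F E (aOf i))))
    (μOf : ι → ∀ v : HeightOneSpectrum (𝓞 F), (LocalRing E v)ˣ →* ℂˣ) (hμn : ∀ i v x, ‖((μOf i v x : ℂˣ) : ℂ)‖ = 1)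
    (hμc : ∀ i v, Continuous fun x => ((μOf i v x : ℂˣ) : ℂ))
    (hμF : ∀ (i : ι) (v : HeightOneSpectrum (𝓞 F)) (t : (v.adicCompletion F)ˣ),
      μOf i v (Units.map (algebraMap (v.adicCompletion F) (LocalRing E v)).toMonoidHom t) = 1 ↔
        ∃ x : (LocalRing E v)ˣ, (x : LocalRing E v) * conjLocal E c v x = algebraMap (v.adicCompletion F) (LocalRing E v) t)
    (v : HeightOneSpectrum (𝓞 F)) (i : ι) (a : Fˣ)
    (z : (localIndexedFamilyAtV F E c N e JV hcδ hδ hd hV hVd hJV hn aOf χOf 𝓢Of μOf hμn hμc hμF v).S.normOne) :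
    ((localIndexedFamilyAtV F E c N e JV hcδ hδ hd hV hVd hJV hn aOf χOf 𝓢Of μOf hμn hμc hμF v).chi i).1 z =
      localCharOfCenter F E c (JW F E a) (JW_apply_ne_zero F E a) (χOf i).1 v
        (LemD1OfPlace.theta E v c N JV hcδ hδ
          (localIndexedFamilyAtV F E c N e JV hcδ hδ hd hV hVd hJV hn aOf χOf 𝓢Of μOf hμn hμc hμF v).S.two_le
          (transpose_map_conj_JV F E c N JV hV hJV) (det_JV_ne_zero F E N JV hVd hJV) (JW F E a) z) := by
  -- by construction `chi i = chiOf … (JW a_i) (localCharOfCenter … (χOf i).1 v) …`, whose character is `χ_{i,v} ∘ θ_{a_i}`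
  change localCharOfCenter F E c (JW F E (aOf i)) (JW_apply_ne_zero F E (aOf i)) (χOf i).1 v
      (LemD1OfPlace.theta E v c N JV hcδ hδ _ (transpose_map_conj_JV F E c N JV hV hJV) (det_JV_ne_zero F E N JV hVd hJV)
        (JW F E (aOf i)) z) = _
  exact localCharOfCenter_theta_eq F E c N JV hcδ hδ _ (transpose_map_conj_JV F E c N JV hV hJV) (det_JV_ne_zero F E N JV hVd hJV)
    v (JW F E (aOf i)) (JW F E a) (JW_apply_ne_zero F E (aOf i)) (JW_apply_ne_zero F E a) (χOf i).1 z

/-- **Step-3 characters under a Galois relation of the global characters**: if `χ_{i₁} = τ ∘ χ_{i₀}` on `E¹(𝔸_{F,f})`, then the members'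
Step-3 characters on `E_v¹` satisfy `χ_{i₁}(z) = τ (χ_{i₀}(z))` — whatever the two lines `⟨a_{i₀}⟩`, `⟨a_{i₁}⟩`.
[cite: Liu2021, Thm. 4.18 (3) proof l. 2272–2289; App. D §D.1 Step 3] [cite: TateThesis1967, §3.2 Lemma 3.2.1] -/
theorem coe_chi_localIndexedFamilyAtV_eq_of_forall (hV : TV.IsSymm) (hVd : IsUnit TV.det)
    (hJV : JV = TV.map (algebraMap F E))
    (hn : 3 ≤ n) {ι : Type} (aOf : ι → Fˣ) (χOf : ι → Chi F E c)
    (𝓢Of : ∀ i, LocalSplitting.FinLocalSplittings F E c n hcδ hδ hd (gram F e TV (TW F (aOf i))) (isSymm_gram F e hV (isSymm_TW F (aOf i)))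
      (reindex_kronecker_eq_gram_map F E e hJV (JW_eq F E (aOf i))))
    (μOf : ι → ∀ v : HeightOneSpectrum (𝓞 F), (LocalRing E v)ˣ →* ℂˣ) (hμn : ∀ i v x, ‖((μOf i v x : ℂˣ) : ℂ)‖ = 1)
    (hμc : ∀ i v, Continuous fun x => ((μOf i v x : ℂˣ) : ℂ))
    (hμF : ∀ (i : ι) (v : HeightOneSpectrum (𝓞 F)) (t : (v.adicCompletion F)ˣ),
      μOf i v (Units.map (algebraMap (v.adicCompletion F) (LocalRing E v)).toMonoidHom t) = 1 ↔
        ∃ x : (LocalRing E v)ˣ, (x : LocalRing E v) * conjLocal E c v x = algebraMap (v.adicCompletion F) (LocalRing E v) t)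
    (v : HeightOneSpectrum (𝓞 F)) (i₀ i₁ : ι) (τ : ℂ →+* ℂ)
    (hχ : ∀ u : finAdelicOne F E c, ((((χOf i₁).1 u : ℂˣ)) : ℂ) = τ ((((χOf i₀).1 u : ℂˣ)) : ℂ))
    (z : (localIndexedFamilyAtV F E c N e JV hcδ hδ hd hV hVd hJV hn aOf χOf 𝓢Of μOf hμn hμc hμF v).S.normOne) :
    ((((localIndexedFamilyAtV F E c N e JV hcδ hδ hd hV hVd hJV hn aOf χOf 𝓢Of μOf hμn hμc hμF v).chi i₁).1 z : ℂˣ) : ℂ) =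
      τ ((((localIndexedFamilyAtV F E c N e JV hcδ hδ hd hV hVd hJV hn aOf χOf 𝓢Of μOf hμn hμc hμF v).chi i₀).1 z : ℂˣ) : ℂ) := by
  -- read both characters at the SAME line `⟨a_{i₀}⟩`, then the local component is `χ` at one adelic point
  rw [coe_chi_localIndexedFamilyAtV_apply F E c N e JV hcδ hδ hd hV hVd hJV hn aOf χOf 𝓢Of μOf hμn hμc hμF v i₁ (aOf i₀) z,
    coe_chi_localIndexedFamilyAtV_apply F E c N e JV hcδ hδ hd hV hVd hJV hn aOf χOf 𝓢Of μOf hμn hμc hμF v i₀ (aOf i₀) z,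
    localCharOfCenter_eq_comp_inclPlace, localCharOfCenter_eq_comp_inclPlace, MonoidHom.comp_apply, MonoidHom.comp_apply,
    MonoidHom.comp_apply, MonoidHom.comp_apply]
  exact hχ _

/-- **III-11a, LAYER A — A SEMILINEAR OSCILLATOR INTERTWINER DESCENDS TO THE `χ`-QUOTIENTS.**  For members `i₀`, `i₁` of the indexed family at
`v`, a field endomorphism `τ` of `ℂ` with `χ_{i₁} = τ ∘ χ_{i₀}` on `E¹(𝔸_{F,f})`, and a bijective `τ`-semilinear `Φ : 𝒮(F_vⁿ) → 𝒮(F_vⁿ)` with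
`Φ (ω_{i₀}(g) f) = ω_{i₁}(g) (Φ f)` for all `g ∈ U(J_V)(F_v)`: there is a bijective `τ`-semilinear map `ω(μ_{i₀}, ε_{i₀}, χ_{i₀}) → ω(μ_{i₁}, ε_{i₁}, χ_{i₁})`
(the family's `quot`) intertwining the `U(J_V)(F_v)`-actions. [cite: Liu2021, Thm. 4.18 (3), proof l. 2272–2289; App. D §D.1 Step 3 (l. 5221)] -/
theorem exists_semilinear_quot_of_omega_intertwiner (hV : TV.IsSymm) (hVd : IsUnit TV.det)
    (hJV : JV = TV.map (algebraMap F E))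
    (hn : 3 ≤ n) {ι : Type} (aOf : ι → Fˣ) (χOf : ι → Chi F E c)
    (𝓢Of : ∀ i, LocalSplitting.FinLocalSplittings F E c n hcδ hδ hd (gram F e TV (TW F (aOf i))) (isSymm_gram F e hV (isSymm_TW F (aOf i)))
      (reindex_kronecker_eq_gram_map F E e hJV (JW_eq F E (aOf i))))
    (μOf : ι → ∀ v : HeightOneSpectrum (𝓞 F), (LocalRing E v)ˣ →* ℂˣ) (hμn : ∀ i v x, ‖((μOf i v x : ℂˣ) : ℂ)‖ = 1)
    (hμc : ∀ i v, Continuous fun x => ((μOf i v x : ℂˣ) : ℂ))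
    (hμF : ∀ (i : ι) (v : HeightOneSpectrum (𝓞 F)) (t : (v.adicCompletion F)ˣ),
      μOf i v (Units.map (algebraMap (v.adicCompletion F) (LocalRing E v)).toMonoidHom t) = 1 ↔
        ∃ x : (LocalRing E v)ˣ, (x : LocalRing E v) * conjLocal E c v x = algebraMap (v.adicCompletion F) (LocalRing E v) t)
    (v : HeightOneSpectrum (𝓞 F)) (i₀ i₁ : ι) (τ : ℂ →+* ℂ)
    (hχ : ∀ u : finAdelicOne F E c, ((((χOf i₁).1 u : ℂˣ)) : ℂ) = τ ((((χOf i₀).1 u : ℂˣ)) : ℂ))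
    (Φ : SchwartzBruhat (Fin n → v.adicCompletion F) →ₛₗ[τ] SchwartzBruhat (Fin n → v.adicCompletion F))
    (hbij : Function.Bijective Φ)
    (hΦ : ∀ (g : (localIndexedFamilyAtV F E c N e JV hcδ hδ hd hV hVd hJV hn aOf χOf 𝓢Of μOf hμn hμc hμF v).S.U)
      (f : SchwartzBruhat (Fin n → v.adicCompletion F)),
      Φ ((localIndexedFamilyAtV F E c N e JV hcδ hδ hd hV hVd hJV hn aOf χOf 𝓢Of μOf hμn hμc hμF v).omega i₀ g f) =
        (localIndexedFamilyAtV F E c N e JV hcδ hδ hd hV hVd hJV hn aOf χOf 𝓢Of μOf hμn hμc hμF v).omega i₁ g (Φ f)) :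
    ∃ h : ((localIndexedFamilyAtV F E c N e JV hcδ hδ hd hV hVd hJV hn aOf χOf 𝓢Of μOf hμn hμc hμF v).V i₀ ⧸
          augmentation ((localIndexedFamilyAtV F E c N e JV hcδ hδ hd hV hVd hJV hn aOf χOf 𝓢Of μOf hμn hμc hμF v).omega i₀)
            (localIndexedFamilyAtV F E c N e JV hcδ hδ hd hV hVd hJV hn aOf χOf 𝓢Of μOf hμn hμc hμF v).S.scalar
            ((localIndexedFamilyAtV F E c N e JV hcδ hδ hd hV hVd hJV hn aOf χOf 𝓢Of μOf hμn hμc hμF v).chi i₀).1) →ₛₗ[τ]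
        ((localIndexedFamilyAtV F E c N e JV hcδ hδ hd hV hVd hJV hn aOf χOf 𝓢Of μOf hμn hμc hμF v).V i₁ ⧸
          augmentation ((localIndexedFamilyAtV F E c N e JV hcδ hδ hd hV hVd hJV hn aOf χOf 𝓢Of μOf hμn hμc hμF v).omega i₁)
            (localIndexedFamilyAtV F E c N e JV hcδ hδ hd hV hVd hJV hn aOf χOf 𝓢Of μOf hμn hμc hμF v).S.scalar
            ((localIndexedFamilyAtV F E c N e JV hcδ hδ hd hV hVd hJV hn aOf χOf 𝓢Of μOf hμn hμc hμF v).chi i₁).1),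
      Function.Bijective h ∧
      ∀ g x, h ((localIndexedFamilyAtV F E c N e JV hcδ hδ hd hV hVd hJV hn aOf χOf 𝓢Of μOf hμn hμc hμF v).quot i₀ g x) =
        (localIndexedFamilyAtV F E c N e JV hcδ hδ hd hV hVd hJV hn aOf χOf 𝓢Of μOf hμn hμc hμF v).quot i₁ g (h x) :=
  exists_semilinear_quotRep_of_bijective _ _ _ _ _
    (localIndexedFamilyAtV F E c N e JV hcδ hδ hd hV hVd hJV hn aOf χOf 𝓢Of μOf hμn hμc hμF v).S.scalar_mem_center Φ hΦ
    (coe_chi_localIndexedFamilyAtV_eq_of_forall F E c N e JV hcδ hδ hd hV hVd hJV hn aOf χOf 𝓢Of μOf hμn hμc hμF v i₀ i₁ τ hχ) hbij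

end Literature.NumberTheory.Automorphic.Liu2021.Def411WeilCarriers

end
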